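import Summits.QuantumFields.YangMills.Theorems.BalabanUVNodesN21LowCentreEndAtSUNBlockChartJacobianEnd
import Summits.QuantumFields.YangMills.Theorems.BalabanUVNodesN21ChartExponentConvexitySUN
import Summits.QuantumFields.YangMills.Theorems.BalabanUVNodesN21ChartExponentConvexityLocalSUN

/-!
# N21 (NE7c) · THE [LF-II] §1-LETTERS END ON THE EXPONENTIAL `SU(N)` BLOCK CHART, VI: the cut chart law's (M1) ∕ `hchart` with BOTH
# the Haar Jacobian (files 11–12) AND the convexity of the dressed exponent (dag-n21-w3 g3's ★★′, WIDTH-209 piece 2) DISCHARGED —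
# displayed: the (1.2) expansion with the PRINTED ROWS, the matrix ∕ linear STRUCTURE of its first two members, and the ANALYTICITY
# LETTER (sup bound on complex `r`-balls) for the third-order member

Width seat pub-ymgap-dag-n21-w1 (g2; director-ym №197 ∕ HUMAN RULING D-0149), node N21 = NE7c (single-run shell-weight
bound, NOT PRINTED in [Bałaban 1983–89], NOT proved), lane K3⁷ `SpineGivenEndpointR13SepCoPH` (stmt-QuantumFields-20544,
`--kind proof --supports … --as helper`).  File 15 of the seat's item-1 chain, RE-CUT as a one-step KNIT: composes BY NAME
`…JacobianEnd` ★ `cutChartLawAC_of_sect1Letters_dressed` ∕ ★ `chartAC_of_sect1Letters_dressed` (p608182; the Jacobian in the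
remainder) with dag-n21-w3 g3's ★★′ `N21ChartExponentConvexitySUN.convexOn_blockChartSU_expansion_of_analyticSupBound` (the
declarer of «convexity of the (1.2) exponent»: coercivity (1.9) + analyticity with a sup bound, Cauchy).  THEOREMS ONLY: 0 `def`,
0 `sorry`; count-neutral; nothing of either file retyped.

WHAT IS PROVED ([bookkeeping] composition BY NAME).
* ★ `cutChartLawAC_of_sect1Letters_analytic` — `…JacobianEnd` ★ with its binder `hA : ConvexOn ℝ K₀ A` PRODUCED by dag-n21-w3's
  ★★′: displayed instead — the quadratic member as a matrix form in flat coordinates `Q v = v̄ ⬝ᵥ (M *ᵥ v̄)` with the (1.9) row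
  `Ineq19` on ALL chart vectors, the linear member `lin = ⇑ℓ`, the third-order member `Vt = Re Φ ∘ (flat, real ↪ complex)` with
  `Φ` complex-differentiable and `‖Φ‖ ≤ S₂` on the `r`-balls about the real points of `K₀`, `diam K₀ < r`, and the convexity clause
  `16·d·(100M)^{d+1}·S₂ ≤ γ₀·r²` — next to ★'s own binders (kept cuts `K₀ ∋ 0` convex, (1.6) on `K₀`, `|Vt| ≤ W_V` on `K₀`, the
  statistic, the odds for the uncut windowed chart law, the numeral's clause with the Jacobian letter `W_J`).
* ★ `chartAC_of_sect1Letters_analytic` — the same for dag-n21-w2's `hchart` itself (adds the dressed presentation `hR` and the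
  reading identity `hread` on the window).

HONEST FRAMING.  Composition BY NAME; what REMAINS located: the (1.2) expansion's identification with the N21 slot's block action
and its rows ([LF-II] p.357–358), the matrix ∕ linear structure of its first two members, the analyticity letter of the third (NODE O's
term object), `hR` ∕ `hlaw` (n21-w2), the statistic's binders (n21-w3's road); nothing of Bałaban's asserted; NE7c NOT PRINTED ∕ NOT
proved; N21 NOT discharged; K3⁷ NOT claimed; counts unmoved (typed 28∕28 · discharged 5∕27); never a count claim; one finite 𝕋⁴ at
fixed ε — R4 would close only the conditional finite-𝕋⁴ rung `BalabanLadder.UV`, NOT the Yang–Mills mass gap (Clay); nothing about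
ℝ⁴ ∕ OS.

v1.1 (APPEND-ONLY; v1 declarations byte-identical): §2 the LOCAL species — ★ `cutChartLawAC_of_sect1Letters_analyticLocal` ∕ ★
`chartAC_of_sect1Letters_analyticLocal` through dag-n21-w3 g4's ★★′-loc `N21ChartExponentConvexityLocalSUN.convexOn_blockChartSU_expansion_of_analyticSupBound_local`
(p613088): NO diameter binder, `0 < r` displayed instead, and the sharper convexity clause `4·d·(100M)^{d+1}·S₂ ≤ γ₀·r²`.
-/

set_option autoImplicit false

noncomputable section

open MeasureTheory Set Function Finset Metric
open scoped ENNReal BigOperators Matrix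

namespace Summit.QuantumFields.YangMills.Theorems.N21LowCentreEndAtSUNBlockChartAnalytic

open Literature.MathematicalPhysics.QuantumFieldTheory.Balaban1983to89
open Literature.MathematicalPhysics.QuantumFieldTheory.Balaban1983to89.T4Continuum
open Literature.MathematicalPhysics.QuantumFieldTheory.Balaban1983to89.Node00 hiding dimSU
open Literature.MathematicalPhysics.QuantumFieldTheory.Balaban1983to89.T4ShellMeasure (SlotAntiConcentration)
open Literature.MathematicalPhysics.QuantumFieldTheory.Balaban1983to89.B16Sect1Wilson (Ineq16 Ineq19)
open Summit.QuantumFields.BalabanUV.T4Continuum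
open Summit.QuantumFields.BalabanUV.T4Continuum.ShellMeasureExpChartSUN (SUN ChartSU BlockChartSU dimSU expFibreChartSU chartWeightSU)
open Summit.QuantumFields.BalabanUV.T4Continuum.ShellMeasureExpJacobianSUN (expJacWeightSU)
open Summit.QuantumFields.BalabanUV.T4Continuum.ShellMeasureExpHaarAreaSUN (kappaSU)
open Summit.QuantumFields.BalabanUV.T4Continuum.ShellMeasureExpDuhamelSUN (duhT)
open Summit.QuantumFields.YangMills.Theorems.N21ShellSplitOfRecord13CoPH (blockReading)
open Summit.QuantumFields.YangMills.Theorems.N21LowCentreEndAtSUNBlockChartJacobianEnd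
  (cutChartLawAC_of_sect1Letters_dressed chartAC_of_sect1Letters_dressed)
open Summit.QuantumFields.YangMills.Theorems.N21ChartExponentConvexitySUN (convexOn_blockChartSU_expansion_of_analyticSupBound)
open Summit.QuantumFields.YangMills.Theorems.N21ChartExponentConvexityLocalSUN (convexOn_blockChartSU_expansion_of_analyticSupBound_local)

variable {N : ℕ} [NeZero N] {P : Params} {j : ℕ}

/-- ★ **THE CUT CHART LAW's (M1) — HAAR JACOBIAN IN THE REMAINDER, CONVEXITY FROM THE (1.9) ROW + ANALYTICITY (dag-n21-w3 ★★′).**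
`…JacobianEnd` ★ `cutChartLawAC_of_sect1Letters_dressed` with `hA : ConvexOn ℝ K₀ A` PRODUCED by
`N21ChartExponentConvexitySUN.convexOn_blockChartSU_expansion_of_analyticSupBound`: the quadratic member `Q` as a matrix form in flat
coordinates with (1.9) on all chart vectors, `lin = ⇑ℓ`, `Vt = Re Φ` at the real points of `K₀` with `Φ` complex-differentiable and
`‖Φ‖ ≤ S₂` on the `r`-balls, `diam K₀ < r`, clause `16·d·(100M)^{d+1}·S₂ ≤ γ₀·r²` ⇒ the cut chart law's (M1) (n21-w2's package
conjunct; `2 ≤ N`, `b` nonempty, `0 < S < π`). [bookkeeping] -/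
theorem cutChartLawAC_of_sect1Letters_analytic (hN : 2 ≤ N) (b : Finset (PBond P j)) (hb : b.Nonempty)
    {S : ℝ} (hS : 0 < S) (hSπ : S < Real.pi)
    (K₀ : Set (BlockChartSU N b)) (A Qf lin Vt : BlockChartSU N b → ℝ)
    (hAm : Measurable fun z : BlockChartSU N b => K₀.indicator (fun w => ENNReal.ofReal (Real.exp (-A w))) z)
    {U : BlockChartSU N b → ℝ} (hUm : Measurable U)
    {C Env : Set (BlockChartSU N b)} (hC : MeasurableSet C) (hEnv : MeasurableSet Env)
    {θ ρ σ κ₀ Q L γ₀ M B₃ M₀ A₀ p₀g Rk WV r S₂ : ℝ} {d : ℕ}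
    (hθ : 0 < θ) (hρ0 : 0 < ρ) (hρ1 : ρ < 1) (hρσ : ρ + σ ≤ 1) (hκ : 0 < κ₀) (hQ0 : 0 ≤ Q) (hL : 0 < L)
    (hd : 1 ≤ d) (hM : 0 < M) (hγ₀ : 0 < γ₀)
    (hW : 0 ≤ 3 * B₃ * M₀ * A₀ ^ 2 * p₀g ^ 2 * Real.exp (-Rk) * (100 * M) ^ 4 + WV)
    (hK₀ : Convex ℝ K₀) (h0K₀ : (0 : BlockChartSU N b) ∈ K₀)
    (hexp : ∀ v ∈ K₀, A v = A 0 + 1 / 2 * Qf v + lin v + Vt v)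
    -- the first two members: a matrix quadratic form with the (1.9) row on all chart vectors, a linear functional with (1.6) on `K₀`
    (Mq : Matrix (↥b × Fin (dimSU N)) (↥b × Fin (dimSU N)) ℝ)
    (hQf : ∀ v, Qf v = (fun q : ↥b × Fin (dimSU N) => v q.1 q.2) ⬝ᵥ (Mq *ᵥ fun q => v q.1 q.2))
    (h19 : ∀ v : BlockChartSU N b, Ineq19 (Qf v) (∑ i, ‖v i‖ ^ 2) γ₀ d M)
    (ℓ : BlockChartSU N b →ₗ[ℝ] ℝ) (hlin : ∀ v, lin v = ℓ v)
    (h16 : ∀ v ∈ K₀, Ineq16 (lin v) B₃ M₀ A₀ p₀g Rk M)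
    -- the third-order member: value bound on `K₀` and the ANALYTICITY LETTER
    (hV : ∀ v ∈ K₀, |Vt v| ≤ WV)
    (Φ : (↥b × Fin (dimSU N) → ℂ) → ℂ)
    (hVt : ∀ x ∈ K₀, Vt x = (Φ fun q => ((x q.1 q.2 : ℝ) : ℂ)).re)
    (hΦd : ∀ x ∈ K₀, DifferentiableOn ℂ Φ (ball (fun q => ((x q.1 q.2 : ℝ) : ℂ)) r))
    (hΦS : ∀ x ∈ K₀, ∀ u ∈ ball (fun q : ↥b × Fin (dimSU N) => ((x q.1 q.2 : ℝ) : ℂ)) r, ‖Φ u‖ ≤ S₂)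
    (hdiam : ∀ x ∈ K₀, ∀ y ∈ K₀, ‖y - x‖ < r)
    (hclause₂ : 16 * d * (100 * M) ^ (d + 1) * S₂ ≤ γ₀ * r ^ 2)
    -- the statistic, the clause with the Jacobian letter, the envelope ∕ transversality ∕ odds
    (hUL : ∀ z z' : BlockChartSU N b, U z - U z' ≤ L * ‖z - z'‖)
    (hUc : U 0 ≤ σ * θ)
    (hclause : 16 * (3 * B₃ * M₀ * A₀ ^ 2 * p₀g ^ 2 * Real.exp (-Rk) * (100 * M) ^ 4 +
        (WV + b.card * ((N * N : ℕ) * (-2 * Real.log (Real.sinc S))))) * d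
      * (100 * M) ^ (d + 1) * (dimSU N * L ^ 2) ≤ γ₀ * (θ * (1 - ρ - σ)) ^ 2)
    (henv : ∀ l ∈ Icc (1 - 1 / ((b.card : ℝ) * dimSU N + 1)) 1, ∀ z : BlockChartSU N b,
      θ * (1 - ρ) ≤ U z → U z < θ → z ∈ C → l • z ∈ Env)
    (hRT : ∀ z : BlockChartSU N b, θ * (1 - ρ) ≤ U z → U z < θ → z ∈ C → ∀ s' : ℝ, 1 ≤ s' →
      θ * (1 - ρ) ≤ U (s' • z) → U (s' • z) < θ → s' • z ∈ C → U z + κ₀ * (θ * (1 - ρ)) * (s' - 1) ≤ U (s' • z))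
    (hQ : ((volume : Measure (BlockChartSU N b)).withDensity fun z =>
        chartWeightSU b S (expJacWeightSU (kappaSU N)) z * K₀.indicator (fun w => ENNReal.ofReal (Real.exp (-A w))) z)
          (Env \ ({z | U z < θ} ∩ C))
      ≤ ENNReal.ofReal Q * ((volume : Measure (BlockChartSU N b)).withDensity fun z =>
        chartWeightSU b S (expJacWeightSU (kappaSU N)) z * K₀.indicator (fun w => ENNReal.ofReal (Real.exp (-A w))) z)
          ({z | U z < θ} ∩ C)) :
    SlotAntiConcentration
      (((volume : Measure (BlockChartSU N b)).withDensity fun z => (K₀ ∩ closedBall (0 : BlockChartSU N b) S).indicator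
        (fun w => ENNReal.ofReal (Real.exp (-(A w +
          (∑ i, -Real.log (LinearMap.det (duhT (w i) : ChartSU N →ₗ[ℝ] ChartSU N))) -
            b.card * Real.log (kappaSU N).toReal)))) z).restrict ({z | U z < θ} ∩ C))
      U θ ρ (3 * ((b.card : ℝ) * dimSU N + 1) * (1 + Q) / (κ₀ * (1 - ρ))) :=
  cutChartLawAC_of_sect1Letters_dressed hN b hb hS hSπ K₀ A Qf lin Vt hAm hUm hC hEnv hθ hρ0 hρ1 hρσ hκ hQ0 hL hd hM hγ₀ hW
    hK₀ (convexOn_blockChartSU_expansion_of_analyticSupBound b hK₀ A Qf lin Vt (A 0) hexp Mq hQf hd hM hγ₀ h19 ℓ hlin Φ hVt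
      hΦd hΦS hdiam hclause₂) h0K₀ hexp (fun v _ => h19 v) h16 hV hUL hUc hclause henv hRT hQ

/-- ★ **JUNCTION №3's `hchart` — HAAR JACOBIAN IN THE REMAINDER, CONVEXITY FROM THE (1.9) ROW + ANALYTICITY.**  `…JacobianEnd` ★
`chartAC_of_sect1Letters_dressed` with `hA` PRODUCED by dag-n21-w3's ★★′: adds the dressed presentation `hR` and the reading
identity `hread` on the window ⇒ (M1) for the chart law of record along `blockReading N u b x ∘ expFibreChartSU b c`. [bookkeeping] -/
theorem chartAC_of_sect1Letters_analytic (hN : 2 ≤ N) (b : Finset (PBond P j)) (hb : b.Nonempty)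
    {S : ℝ} (hS : 0 < S) (hSπ : S < Real.pi) (c : GaugeField P j (SU N)) (R : (↥b → SU N) → ℝ≥0∞)
    (u : GaugeField P j (SU N) → ℝ) (x : GaugeField P j (SU N))
    (K₀ : Set (BlockChartSU N b)) (A Qf lin Vt : BlockChartSU N b → ℝ)
    (hAm : Measurable fun z : BlockChartSU N b => K₀.indicator (fun w => ENNReal.ofReal (Real.exp (-A w))) z)
    {U : BlockChartSU N b → ℝ} (hUm : Measurable U)
    {C Env : Set (BlockChartSU N b)} (hC : MeasurableSet C) (hEnv : MeasurableSet Env)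
    {θ ρ σ κ₀ Q L γ₀ M B₃ M₀ A₀ p₀g Rk WV r S₂ : ℝ} {d : ℕ}
    (hθ : 0 < θ) (hρ0 : 0 < ρ) (hρ1 : ρ < 1) (hρσ : ρ + σ ≤ 1) (hκ : 0 < κ₀) (hQ0 : 0 ≤ Q) (hL : 0 < L)
    (hd : 1 ≤ d) (hM : 0 < M) (hγ₀ : 0 < γ₀)
    (hW : 0 ≤ 3 * B₃ * M₀ * A₀ ^ 2 * p₀g ^ 2 * Real.exp (-Rk) * (100 * M) ^ 4 + WV)
    (hK₀ : Convex ℝ K₀) (h0K₀ : (0 : BlockChartSU N b) ∈ K₀)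
    (hexp : ∀ v ∈ K₀, A v = A 0 + 1 / 2 * Qf v + lin v + Vt v)
    (Mq : Matrix (↥b × Fin (dimSU N)) (↥b × Fin (dimSU N)) ℝ)
    (hQf : ∀ v, Qf v = (fun q : ↥b × Fin (dimSU N) => v q.1 q.2) ⬝ᵥ (Mq *ᵥ fun q => v q.1 q.2))
    (h19 : ∀ v : BlockChartSU N b, Ineq19 (Qf v) (∑ i, ‖v i‖ ^ 2) γ₀ d M)
    (ℓ : BlockChartSU N b →ₗ[ℝ] ℝ) (hlin : ∀ v, lin v = ℓ v)
    (h16 : ∀ v ∈ K₀, Ineq16 (lin v) B₃ M₀ A₀ p₀g Rk M)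
    (hV : ∀ v ∈ K₀, |Vt v| ≤ WV)
    (Φ : (↥b × Fin (dimSU N) → ℂ) → ℂ)
    (hVt : ∀ x ∈ K₀, Vt x = (Φ fun q => ((x q.1 q.2 : ℝ) : ℂ)).re)
    (hΦd : ∀ x ∈ K₀, DifferentiableOn ℂ Φ (ball (fun q => ((x q.1 q.2 : ℝ) : ℂ)) r))
    (hΦS : ∀ x ∈ K₀, ∀ u ∈ ball (fun q : ↥b × Fin (dimSU N) => ((x q.1 q.2 : ℝ) : ℂ)) r, ‖Φ u‖ ≤ S₂)
    (hdiam : ∀ x ∈ K₀, ∀ y ∈ K₀, ‖y - x‖ < r)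
    (hclause₂ : 16 * d * (100 * M) ^ (d + 1) * S₂ ≤ γ₀ * r ^ 2)
    (hUL : ∀ z z' : BlockChartSU N b, U z - U z' ≤ L * ‖z - z'‖)
    (hUc : U 0 ≤ σ * θ)
    (hclause : 16 * (3 * B₃ * M₀ * A₀ ^ 2 * p₀g ^ 2 * Real.exp (-Rk) * (100 * M) ^ 4 +
        (WV + b.card * ((N * N : ℕ) * (-2 * Real.log (Real.sinc S))))) * d
      * (100 * M) ^ (d + 1) * (dimSU N * L ^ 2) ≤ γ₀ * (θ * (1 - ρ - σ)) ^ 2)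
    (henv : ∀ l ∈ Icc (1 - 1 / ((b.card : ℝ) * dimSU N + 1)) 1, ∀ z : BlockChartSU N b,
      θ * (1 - ρ) ≤ U z → U z < θ → z ∈ C → l • z ∈ Env)
    (hRT : ∀ z : BlockChartSU N b, θ * (1 - ρ) ≤ U z → U z < θ → z ∈ C → ∀ s' : ℝ, 1 ≤ s' →
      θ * (1 - ρ) ≤ U (s' • z) → U (s' • z) < θ → s' • z ∈ C → U z + κ₀ * (θ * (1 - ρ)) * (s' - 1) ≤ U (s' • z))
    (hQ : ((volume : Measure (BlockChartSU N b)).withDensity fun z =>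
        chartWeightSU b S (expJacWeightSU (kappaSU N)) z * K₀.indicator (fun w => ENNReal.ofReal (Real.exp (-A w))) z)
          (Env \ ({z | U z < θ} ∩ C))
      ≤ ENNReal.ofReal Q * ((volume : Measure (BlockChartSU N b)).withDensity fun z =>
        chartWeightSU b S (expJacWeightSU (kappaSU N)) z * K₀.indicator (fun w => ENNReal.ofReal (Real.exp (-A w))) z)
          ({z | U z < θ} ∩ C))
    (hR : ∀ z ∈ closedBall (0 : BlockChartSU N b) S, R (expFibreChartSU b c z) =
      ({z | U z < θ} ∩ C).indicator (fun z' => K₀.indicator (fun w => ENNReal.ofReal (Real.exp (-A w))) z') z)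
    (hread : ∀ z ∈ closedBall (0 : BlockChartSU N b) S, blockReading N u b x (expFibreChartSU b c z) = U z) :
    SlotAntiConcentration ((volume : Measure (BlockChartSU N b)).withDensity fun z =>
        chartWeightSU b S (expJacWeightSU (kappaSU N)) z * R (expFibreChartSU b c z))
      (blockReading N u b x ∘ expFibreChartSU b c) θ ρ (3 * ((b.card : ℝ) * dimSU N + 1) * (1 + Q) / (κ₀ * (1 - ρ))) :=
  chartAC_of_sect1Letters_dressed hN b hb hS hSπ c R u x K₀ A Qf lin Vt hAm hUm hC hEnv hθ hρ0 hρ1 hρσ hκ hQ0 hL hd hM hγ₀ hW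
    hK₀ (convexOn_blockChartSU_expansion_of_analyticSupBound b hK₀ A Qf lin Vt (A 0) hexp Mq hQf hd hM hγ₀ h19 ℓ hlin Φ hVt
      hΦd hΦS hdiam hclause₂) h0K₀ hexp (fun v _ => h19 v) h16 hV hUL hUc hclause henv hRT hQ hR hread

/-! ## §2 (v1.1)  The LOCAL species: no diameter binder, clause `4·d·(100M)^{d+1}·S₂ ≤ γ₀·r²` (dag-n21-w3 g4 ★★′-loc) -/

/-- ★ (v1.1, LOCAL) **THE CUT CHART LAW's (M1)** — as the v1 ★ (Haar Jacobian in the remainder, convexity from the (1.9) row + analyticity)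
but with `hA` PRODUCED by ★★′-loc: NO diameter binder (`0 < r` displayed) and the clause `4·d·(100M)^{d+1}·S₂ ≤ γ₀·r²`. [bookkeeping] -/
theorem cutChartLawAC_of_sect1Letters_analyticLocal (hN : 2 ≤ N) (b : Finset (PBond P j)) (hb : b.Nonempty)
    {S : ℝ} (hS : 0 < S) (hSπ : S < Real.pi)
    (K₀ : Set (BlockChartSU N b)) (A Qf lin Vt : BlockChartSU N b → ℝ)
    (hAm : Measurable fun z : BlockChartSU N b => K₀.indicator (fun w => ENNReal.ofReal (Real.exp (-A w))) z)
    {U : BlockChartSU N b → ℝ} (hUm : Measurable U)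
    {C Env : Set (BlockChartSU N b)} (hC : MeasurableSet C) (hEnv : MeasurableSet Env)
    {θ ρ σ κ₀ Q L γ₀ M B₃ M₀ A₀ p₀g Rk WV r S₂ : ℝ} {d : ℕ}
    (hθ : 0 < θ) (hρ0 : 0 < ρ) (hρ1 : ρ < 1) (hρσ : ρ + σ ≤ 1) (hκ : 0 < κ₀) (hQ0 : 0 ≤ Q) (hL : 0 < L)
    (hd : 1 ≤ d) (hM : 0 < M) (hγ₀ : 0 < γ₀) (hr : 0 < r)
    (hW : 0 ≤ 3 * B₃ * M₀ * A₀ ^ 2 * p₀g ^ 2 * Real.exp (-Rk) * (100 * M) ^ 4 + WV)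
    (hK₀ : Convex ℝ K₀) (h0K₀ : (0 : BlockChartSU N b) ∈ K₀)
    (hexp : ∀ v ∈ K₀, A v = A 0 + 1 / 2 * Qf v + lin v + Vt v)
    -- the first two members: a matrix quadratic form with the (1.9) row on all chart vectors, a linear functional with (1.6) on `K₀`
    (Mq : Matrix (↥b × Fin (dimSU N)) (↥b × Fin (dimSU N)) ℝ)
    (hQf : ∀ v, Qf v = (fun q : ↥b × Fin (dimSU N) => v q.1 q.2) ⬝ᵥ (Mq *ᵥ fun q => v q.1 q.2))
    (h19 : ∀ v : BlockChartSU N b, Ineq19 (Qf v) (∑ i, ‖v i‖ ^ 2) γ₀ d M)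
    (ℓ : BlockChartSU N b →ₗ[ℝ] ℝ) (hlin : ∀ v, lin v = ℓ v)
    (h16 : ∀ v ∈ K₀, Ineq16 (lin v) B₃ M₀ A₀ p₀g Rk M)
    -- the third-order member: value bound on `K₀` and the ANALYTICITY LETTER
    (hV : ∀ v ∈ K₀, |Vt v| ≤ WV)
    (Φ : (↥b × Fin (dimSU N) → ℂ) → ℂ)
    (hVt : ∀ x ∈ K₀, Vt x = (Φ fun q => ((x q.1 q.2 : ℝ) : ℂ)).re)
    (hΦd : ∀ x ∈ K₀, DifferentiableOn ℂ Φ (ball (fun q => ((x q.1 q.2 : ℝ) : ℂ)) r))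
    (hΦS : ∀ x ∈ K₀, ∀ u ∈ ball (fun q : ↥b × Fin (dimSU N) => ((x q.1 q.2 : ℝ) : ℂ)) r, ‖Φ u‖ ≤ S₂)
    (hclause₂ : 4 * d * (100 * M) ^ (d + 1) * S₂ ≤ γ₀ * r ^ 2)
    -- the statistic, the clause with the Jacobian letter, the envelope ∕ transversality ∕ odds
    (hUL : ∀ z z' : BlockChartSU N b, U z - U z' ≤ L * ‖z - z'‖)
    (hUc : U 0 ≤ σ * θ)
    (hclause : 16 * (3 * B₃ * M₀ * A₀ ^ 2 * p₀g ^ 2 * Real.exp (-Rk) * (100 * M) ^ 4 +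
        (WV + b.card * ((N * N : ℕ) * (-2 * Real.log (Real.sinc S))))) * d
      * (100 * M) ^ (d + 1) * (dimSU N * L ^ 2) ≤ γ₀ * (θ * (1 - ρ - σ)) ^ 2)
    (henv : ∀ l ∈ Icc (1 - 1 / ((b.card : ℝ) * dimSU N + 1)) 1, ∀ z : BlockChartSU N b,
      θ * (1 - ρ) ≤ U z → U z < θ → z ∈ C → l • z ∈ Env)
    (hRT : ∀ z : BlockChartSU N b, θ * (1 - ρ) ≤ U z → U z < θ → z ∈ C → ∀ s' : ℝ, 1 ≤ s' →
      θ * (1 - ρ) ≤ U (s' • z) → U (s' • z) < θ → s' • z ∈ C → U z + κ₀ * (θ * (1 - ρ)) * (s' - 1) ≤ U (s' • z))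
    (hQ : ((volume : Measure (BlockChartSU N b)).withDensity fun z =>
        chartWeightSU b S (expJacWeightSU (kappaSU N)) z * K₀.indicator (fun w => ENNReal.ofReal (Real.exp (-A w))) z)
          (Env \ ({z | U z < θ} ∩ C))
      ≤ ENNReal.ofReal Q * ((volume : Measure (BlockChartSU N b)).withDensity fun z =>
        chartWeightSU b S (expJacWeightSU (kappaSU N)) z * K₀.indicator (fun w => ENNReal.ofReal (Real.exp (-A w))) z)
          ({z | U z < θ} ∩ C)) :
    SlotAntiConcentration
      (((volume : Measure (BlockChartSU N b)).withDensity fun z => (K₀ ∩ closedBall (0 : BlockChartSU N b) S).indicator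
        (fun w => ENNReal.ofReal (Real.exp (-(A w +
          (∑ i, -Real.log (LinearMap.det (duhT (w i) : ChartSU N →ₗ[ℝ] ChartSU N))) -
            b.card * Real.log (kappaSU N).toReal)))) z).restrict ({z | U z < θ} ∩ C))
      U θ ρ (3 * ((b.card : ℝ) * dimSU N + 1) * (1 + Q) / (κ₀ * (1 - ρ))) :=
  cutChartLawAC_of_sect1Letters_dressed hN b hb hS hSπ K₀ A Qf lin Vt hAm hUm hC hEnv hθ hρ0 hρ1 hρσ hκ hQ0 hL hd hM hγ₀ hW
    hK₀ (convexOn_blockChartSU_expansion_of_analyticSupBound_local b hK₀ A Qf lin Vt (A 0) hexp Mq hQf hd hM h19 ℓ hlin Φ hr hVt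
      hΦd hΦS hclause₂) h0K₀ hexp (fun v _ => h19 v) h16 hV hUL hUc hclause henv hRT hQ

/-- ★ (v1.1, LOCAL) **JUNCTION №3's `hchart` — the LOCAL species** (`hA` by ★★′-loc; no diameter binder, clause `4·…`).
[bookkeeping] -/
theorem chartAC_of_sect1Letters_analyticLocal (hN : 2 ≤ N) (b : Finset (PBond P j)) (hb : b.Nonempty)
    {S : ℝ} (hS : 0 < S) (hSπ : S < Real.pi) (c : GaugeField P j (SU N)) (R : (↥b → SU N) → ℝ≥0∞)
    (u : GaugeField P j (SU N) → ℝ) (x : GaugeField P j (SU N))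
    (K₀ : Set (BlockChartSU N b)) (A Qf lin Vt : BlockChartSU N b → ℝ)
    (hAm : Measurable fun z : BlockChartSU N b => K₀.indicator (fun w => ENNReal.ofReal (Real.exp (-A w))) z)
    {U : BlockChartSU N b → ℝ} (hUm : Measurable U)
    {C Env : Set (BlockChartSU N b)} (hC : MeasurableSet C) (hEnv : MeasurableSet Env)
    {θ ρ σ κ₀ Q L γ₀ M B₃ M₀ A₀ p₀g Rk WV r S₂ : ℝ} {d : ℕ}
    (hθ : 0 < θ) (hρ0 : 0 < ρ) (hρ1 : ρ < 1) (hρσ : ρ + σ ≤ 1) (hκ : 0 < κ₀) (hQ0 : 0 ≤ Q) (hL : 0 < L)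
    (hd : 1 ≤ d) (hM : 0 < M) (hγ₀ : 0 < γ₀) (hr : 0 < r)
    (hW : 0 ≤ 3 * B₃ * M₀ * A₀ ^ 2 * p₀g ^ 2 * Real.exp (-Rk) * (100 * M) ^ 4 + WV)
    (hK₀ : Convex ℝ K₀) (h0K₀ : (0 : BlockChartSU N b) ∈ K₀)
    (hexp : ∀ v ∈ K₀, A v = A 0 + 1 / 2 * Qf v + lin v + Vt v)
    (Mq : Matrix (↥b × Fin (dimSU N)) (↥b × Fin (dimSU N)) ℝ)
    (hQf : ∀ v, Qf v = (fun q : ↥b × Fin (dimSU N) => v q.1 q.2) ⬝ᵥ (Mq *ᵥ fun q => v q.1 q.2))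
    (h19 : ∀ v : BlockChartSU N b, Ineq19 (Qf v) (∑ i, ‖v i‖ ^ 2) γ₀ d M)
    (ℓ : BlockChartSU N b →ₗ[ℝ] ℝ) (hlin : ∀ v, lin v = ℓ v)
    (h16 : ∀ v ∈ K₀, Ineq16 (lin v) B₃ M₀ A₀ p₀g Rk M)
    (hV : ∀ v ∈ K₀, |Vt v| ≤ WV)
    (Φ : (↥b × Fin (dimSU N) → ℂ) → ℂ)
    (hVt : ∀ x ∈ K₀, Vt x = (Φ fun q => ((x q.1 q.2 : ℝ) : ℂ)).re)
    (hΦd : ∀ x ∈ K₀, DifferentiableOn ℂ Φ (ball (fun q => ((x q.1 q.2 : ℝ) : ℂ)) r))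
    (hΦS : ∀ x ∈ K₀, ∀ u ∈ ball (fun q : ↥b × Fin (dimSU N) => ((x q.1 q.2 : ℝ) : ℂ)) r, ‖Φ u‖ ≤ S₂)
    (hclause₂ : 4 * d * (100 * M) ^ (d + 1) * S₂ ≤ γ₀ * r ^ 2)
    (hUL : ∀ z z' : BlockChartSU N b, U z - U z' ≤ L * ‖z - z'‖)
    (hUc : U 0 ≤ σ * θ)
    (hclause : 16 * (3 * B₃ * M₀ * A₀ ^ 2 * p₀g ^ 2 * Real.exp (-Rk) * (100 * M) ^ 4 +
        (WV + b.card * ((N * N : ℕ) * (-2 * Real.log (Real.sinc S))))) * d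
      * (100 * M) ^ (d + 1) * (dimSU N * L ^ 2) ≤ γ₀ * (θ * (1 - ρ - σ)) ^ 2)
    (henv : ∀ l ∈ Icc (1 - 1 / ((b.card : ℝ) * dimSU N + 1)) 1, ∀ z : BlockChartSU N b,
      θ * (1 - ρ) ≤ U z → U z < θ → z ∈ C → l • z ∈ Env)
    (hRT : ∀ z : BlockChartSU N b, θ * (1 - ρ) ≤ U z → U z < θ → z ∈ C → ∀ s' : ℝ, 1 ≤ s' →
      θ * (1 - ρ) ≤ U (s' • z) → U (s' • z) < θ → s' • z ∈ C → U z + κ₀ * (θ * (1 - ρ)) * (s' - 1) ≤ U (s' • z))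
    (hQ : ((volume : Measure (BlockChartSU N b)).withDensity fun z =>
        chartWeightSU b S (expJacWeightSU (kappaSU N)) z * K₀.indicator (fun w => ENNReal.ofReal (Real.exp (-A w))) z)
          (Env \ ({z | U z < θ} ∩ C))
      ≤ ENNReal.ofReal Q * ((volume : Measure (BlockChartSU N b)).withDensity fun z =>
        chartWeightSU b S (expJacWeightSU (kappaSU N)) z * K₀.indicator (fun w => ENNReal.ofReal (Real.exp (-A w))) z)
          ({z | U z < θ} ∩ C))
    (hR : ∀ z ∈ closedBall (0 : BlockChartSU N b) S, R (expFibreChartSU b c z) =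
      ({z | U z < θ} ∩ C).indicator (fun z' => K₀.indicator (fun w => ENNReal.ofReal (Real.exp (-A w))) z') z)
    (hread : ∀ z ∈ closedBall (0 : BlockChartSU N b) S, blockReading N u b x (expFibreChartSU b c z) = U z) :
    SlotAntiConcentration ((volume : Measure (BlockChartSU N b)).withDensity fun z =>
        chartWeightSU b S (expJacWeightSU (kappaSU N)) z * R (expFibreChartSU b c z))
      (blockReading N u b x ∘ expFibreChartSU b c) θ ρ (3 * ((b.card : ℝ) * dimSU N + 1) * (1 + Q) / (κ₀ * (1 - ρ))) :=
  chartAC_of_sect1Letters_dressed hN b hb hS hSπ c R u x K₀ A Qf lin Vt hAm hUm hC hEnv hθ hρ0 hρ1 hρσ hκ hQ0 hL hd hM hγ₀ hW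
    hK₀ (convexOn_blockChartSU_expansion_of_analyticSupBound_local b hK₀ A Qf lin Vt (A 0) hexp Mq hQf hd hM h19 ℓ hlin Φ hr hVt
      hΦd hΦS hclause₂) h0K₀ hexp (fun v _ => h19 v) h16 hV hUL hUc hclause henv hRT hQ hR hread

end Summit.QuantumFields.YangMills.Theorems.N21LowCentreEndAtSUNBlockChartAnalytic

end
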